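import Summits.CriticalPhenomena.PercolationContinuityZ3.Theorems.PercNearOneGluingNoHeavyPcintWindowAut
import HarnessLib

/-!
# PCINT lane: a window certificate gives `p ≤ p_c^bond(ℤ^d)` (assembly for certificate kind B3)

Cell `prim-pcint`, seat `prim-pcint-2`; memo `run/shared/lean/prim/pcint/REDUCTIONS.md` §R2.5 and §B3.
Does NOT build on p205010.  Continuation of `…PcintWindowAut.lean` (the weighted window automaton, its run along
a self-avoiding word, the chord accounting): here the pointwise domination `p^{m+k}(1-p)^{#chords} ≤ p^m · run`
(`chordWeight_le_run`) and the assembly `le_criticalProb_zd_of_windowCert`: an acceptance test `ok` accepting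
every self-avoiding extended window, a chord count `c ≤` the genuine window chords, and a positive vector `v` with
the Collatz–Wielandt inequalities at some `λ < 1` give `θ(p) = 0` and `p ≤ p_c^bond(ℤ^d)` (via the B3 glue
`le_criticalProb_zd_of_chordWeight_le_geometric`).  Instances (`decide +kernel`) live in separate files.
-/

noncomputable section

namespace Summit.CriticalPhenomena.PercolationContinuityZ3.Theorems.Pcint

open Finset Literature.Probability.Percolation Literature.Probability.LatticeModels

variable {d m : ℕ} (a₀ : Fin d × Bool)

/-! ### Assembly: a window certificate gives `p ≤ p_c^bond(ℤ^d)` -/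

/-- The row sum of the window automaton in explicit form. [folklore] -/
theorem stepSum_windowAut (ok : (Fin m → Fin d × Bool) → Fin d × Bool → Bool)
    (c : (Fin m → Fin d × Bool) → Fin d × Bool → ℕ) {p : ℝ} (hp0 : 0 ≤ p) (hp1 : p ≤ 1)
    (v : (Fin m → Fin d × Bool) → ℝ) (u : Fin m → Fin d × Bool) :
    (windowAut ok c p hp0 hp1).stepSum v u =
      ∑ a : Fin d × Bool, if ok u a then p * (1 - p) ^ c u a * v (wshift u a) else 0 := by
  unfold WAut.stepSum windowAut
  refine Finset.sum_congr rfl fun a _ => ?_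
  by_cases h : ok u a <;> simp [h]

/-- The first window and the tail of an appended word. [folklore] -/
theorem winAt_append_zero {k : ℕ} (u : Fin m → Fin d × Bool) (r : Fin k → Fin d × Bool) :
    winAt (m := m) a₀ (Fin.append u r) 0 = u := by
  funext i
  rw [winAt, zero_add, wordAt_of_lt a₀ _ (by omega : i.1 < m + k)]
  exact Fin.append_left u r i

/-- The tail of an appended word is the second part. [folklore] -/
theorem tail_append {k : ℕ} (u : Fin m → Fin d × Bool) (r : Fin k → Fin d × Bool) :
    (fun j : Fin k => Fin.append u r ⟨m + j.1, by omega⟩) = r := by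
  funext j
  exact Fin.append_right u r j

/-- **The pointwise domination** (REDUCTIONS §R2.2 for kind B3): for a self-avoiding word of length `m + k`,
`p^{m+k} (1-p)^{#chordEdges w} ≤ p^m · run_k(first window, tail)`. [folklore] -/
theorem chordWeight_le_run (a₀ : Fin d × Bool) {ok : (Fin m → Fin d × Bool) → Fin d × Bool → Bool}
    {c : (Fin m → Fin d × Bool) → Fin d × Bool → ℕ}
    (hok : ∀ u a, IsSAW (wext u a) → ok u a = true) (hc : ∀ u a, IsSAW (wext u a) → c u a ≤ winChordTrue u a)
    {p : ℝ} (hp0 : 0 ≤ p) (hp1 : p ≤ 1) {k : ℕ} {w : Fin (m + k) → Fin d × Bool} (hw : IsSAW w) :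
    p ^ (m + k) * (1 - p) ^ (chordEdges w).card ≤
      p ^ m * (windowAut ok c p hp0 hp1).run k (winAt a₀ w 0) (fun j => w ⟨m + j.1, by omega⟩) := by
  have hsaw : ∀ t < k, IsSAW (wext (winAt (m := m) a₀ w t) (wordAt a₀ w (t + m))) :=
    fun t ht => isSAW_wext_winAt a₀ hw (by omega)
  rw [run_windowAut_eq a₀ ok c hp0 hp1 k w (fun t ht => hok _ _ (hsaw t ht)), Finset.prod_mul_distrib,
    Finset.prod_const, Finset.card_range, Finset.prod_pow_eq_pow_sum, pow_add, mul_assoc]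
  refine mul_le_mul_of_nonneg_left (mul_le_mul_of_nonneg_left ?_ (pow_nonneg hp0 _)) (pow_nonneg hp0 _)
  refine pow_le_pow_of_le_one (by linarith) (by linarith) ?_
  calc ∑ t ∈ Finset.range k, c (winAt a₀ w t) (wordAt a₀ w (t + m))
      ≤ ∑ t ∈ Finset.range k, winChordTrue (winAt (m := m) a₀ w t) (wordAt a₀ w (t + m)) :=
        Finset.sum_le_sum fun t ht => hc _ _ (hsaw t (Finset.mem_range.1 ht))
    _ ≤ (chordEdges w).card := sum_winChordTrue_le_card_chordEdges a₀ hw le_rfl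

/-- **Window certificate ⇒ lower bound on `p_c^bond(ℤ^d)`** (REDUCTIONS §R2.5 for kind B3 `chord_cw`, kernel
form). Given an acceptance test `ok` that accepts every self-avoiding extended window, a chord count `c` bounded by
the genuine window chords, and a positive vector `v` on windows with the Collatz–Wielandt inequalities
`Σ_a [ok u a] p(1-p)^{c u a} v(wshift u a) ≤ λ v(u)` for some `λ < 1`, we get `θ(p) = 0` and `p ≤ p_c`. [folklore] -/
theorem le_criticalProb_zd_of_windowCert (a₀ : Fin d × Bool) (ok : (Fin m → Fin d × Bool) → Fin d × Bool → Bool)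
    (c : (Fin m → Fin d × Bool) → Fin d × Bool → ℕ)
    (hok : ∀ u a, IsSAW (wext u a) → ok u a = true) (hc : ∀ u a, IsSAW (wext u a) → c u a ≤ winChordTrue u a)
    (p : unitInterval) (v : (Fin m → Fin d × Bool) → ℝ) {vmin vmax lam : ℝ} (hvmin : 0 < vmin)
    (hv : ∀ u, vmin ≤ v u) (hvmax : ∀ u, v u ≤ vmax) (hlam0 : 0 < lam) (hlam1 : lam < 1)
    (hcw : ∀ u, (∑ a : Fin d × Bool, if ok u a then (p : ℝ) * (1 - p) ^ c u a * v (wshift u a) else 0) ≤ lam * v u) :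
    (p : ℝ) ≤ criticalProb (zdGraph d) 0 := by
  classical
  have hp0 : (0 : ℝ) ≤ p := p.2.1
  have hp1 : (p : ℝ) ≤ 1 := p.2.2
  set M := windowAut ok c (p : ℝ) hp0 hp1 with hM
  have hcw' : ∀ u, M.stepSum v u ≤ lam * v u := fun u => by rw [hM, stepSum_windowAut]; exact hcw u
  have hvmax0 : 0 ≤ vmax := hvmin.le.trans ((hv (fun _ => a₀)).trans (hvmax _))
  -- the constant
  set C : ℝ := (∑ n ∈ Finset.range m, (2 * d : ℝ) ^ n / lam ^ n) + (2 * d : ℝ) ^ m * vmax / (vmin * lam ^ m)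
    with hC
  refine le_criticalProb_zd_of_chordWeight_le_geometric d p hlam0.le hlam1 (C := C) fun n => ?_
  by_cases hn : n < m
  · -- short words: crude count
    have hcount : ∑ w ∈ sawWords d n, (p : ℝ) ^ n * (1 - p) ^ (chordEdges w).card ≤ (2 * d : ℝ) ^ n := by
      calc ∑ w ∈ sawWords d n, (p : ℝ) ^ n * (1 - p) ^ (chordEdges w).card
          ≤ ∑ _w ∈ sawWords d n, (1 : ℝ) := Finset.sum_le_sum fun w _ =>
            mul_le_one₀ (pow_le_one₀ hp0 hp1) (pow_nonneg (by linarith) _) (pow_le_one₀ (by linarith) (by linarith))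
        _ = (sawWords d n).card := by simp
        _ ≤ ((Finset.univ : Finset (Fin n → Fin d × Bool)).card : ℝ) := by
            exact_mod_cast Finset.card_le_univ _
        _ = (2 * d : ℝ) ^ n := by
            rw [Finset.card_univ, Fintype.card_fun, Fintype.card_prod, Fintype.card_fin, Fintype.card_fin,
              Fintype.card_bool]; push_cast; ring
    have hterm : (2 * d : ℝ) ^ n ≤ C * lam ^ n := by
      have h1 : (2 * d : ℝ) ^ n = ((2 * d : ℝ) ^ n / lam ^ n) * lam ^ n := by
        rw [div_mul_cancel₀]; exact (pow_pos hlam0 n).ne'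
      rw [h1]
      refine mul_le_mul_of_nonneg_right ?_ (pow_nonneg hlam0.le _)
      rw [hC]
      have hle : (2 * d : ℝ) ^ n / lam ^ n ≤ ∑ i ∈ Finset.range m, (2 * d : ℝ) ^ i / lam ^ i :=
        Finset.single_le_sum (f := fun i => (2 * d : ℝ) ^ i / lam ^ i) (fun i _ => by positivity)
          (Finset.mem_range.2 hn)
      have : 0 ≤ (2 * d : ℝ) ^ m * vmax / (vmin * lam ^ m) :=
        div_nonneg (mul_nonneg (by positivity) hvmax0) (by positivity)
      linarith
    exact hcount.trans hterm
  · -- long words: n = m + k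
    obtain ⟨k, rfl⟩ : ∃ k, n = m + k := ⟨n - m, by omega⟩
    have hpt : ∀ w ∈ sawWords d (m + k), (p : ℝ) ^ (m + k) * (1 - p) ^ (chordEdges w).card ≤
        (p : ℝ) ^ m * M.run k (winAt a₀ w 0) (fun j => w ⟨m + j.1, by omega⟩) :=
      fun w hw => chordWeight_le_run a₀ hok hc hp0 hp1 (mem_sawWords.1 hw)
    have hall : ∑ w ∈ sawWords d (m + k), (p : ℝ) ^ (m + k) * (1 - p) ^ (chordEdges w).card ≤
        ∑ w : Fin (m + k) → Fin d × Bool, (p : ℝ) ^ m * M.run k (winAt a₀ w 0) (fun j => w ⟨m + j.1, by omega⟩) :=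
      (Finset.sum_le_sum hpt).trans (Finset.sum_le_univ_sum_of_nonneg fun w =>
        mul_nonneg (pow_nonneg hp0 _) (M.run_nonneg _ _ _))
    have hsplit : ∑ w : Fin (m + k) → Fin d × Bool, (p : ℝ) ^ m * M.run k (winAt a₀ w 0) (fun j => w ⟨m + j.1, by omega⟩)
        = (p : ℝ) ^ m * ∑ u : Fin m → Fin d × Bool, M.total k u := by
      rw [← (Fin.appendEquiv m k).sum_comp, Fintype.sum_prod_type, Finset.mul_sum]
      refine Finset.sum_congr rfl fun u _ => ?_
      rw [WAut.total, Finset.mul_sum]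
      refine Finset.sum_congr rfl fun r _ => ?_
      simp only [Fin.appendEquiv, Equiv.coe_fn_mk]
      rw [winAt_append_zero, tail_append]
    have htot : ∑ u : Fin m → Fin d × Bool, M.total k u ≤ (2 * d : ℝ) ^ m * (lam ^ k * vmax / vmin) := by
      calc ∑ u : Fin m → Fin d × Bool, M.total k u ≤ ∑ _u : Fin m → Fin d × Bool, lam ^ k * vmax / vmin := by
            refine Finset.sum_le_sum fun u _ => (M.total_le_of_cw hvmin hv hlam0.le hcw' k u).trans ?_
            exact div_le_div_of_nonneg_right (mul_le_mul_of_nonneg_left (hvmax u) (pow_nonneg hlam0.le _)) hvmin.le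
        _ = (2 * d : ℝ) ^ m * (lam ^ k * vmax / vmin) := by
            rw [Finset.sum_const, Finset.card_univ, Fintype.card_fun, Fintype.card_prod, Fintype.card_fin,
              Fintype.card_fin, Fintype.card_bool, nsmul_eq_mul]; push_cast; ring
    calc ∑ w ∈ sawWords d (m + k), (p : ℝ) ^ (m + k) * (1 - p) ^ (chordEdges w).card
        ≤ (p : ℝ) ^ m * ∑ u : Fin m → Fin d × Bool, M.total k u := hall.trans hsplit.le
      _ ≤ 1 * ((2 * d : ℝ) ^ m * (lam ^ k * vmax / vmin)) :=
          mul_le_mul (pow_le_one₀ hp0 hp1) htot (Finset.sum_nonneg fun u _ =>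
            Finset.sum_nonneg fun w _ => M.run_nonneg _ _ _) zero_le_one
      _ = ((2 * d : ℝ) ^ m * vmax / (vmin * lam ^ m)) * lam ^ (m + k) := by
          field_simp; ring
      _ ≤ C * lam ^ (m + k) := by
          refine mul_le_mul_of_nonneg_right ?_ (pow_nonneg hlam0.le _)
          rw [hC]
          have : 0 ≤ ∑ i ∈ Finset.range m, (2 * d : ℝ) ^ i / lam ^ i :=
            Finset.sum_nonneg fun i _ => by positivity
          linarith

end Summit.CriticalPhenomena.PercolationContinuityZ3.Theorems.Pcint
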